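import Literature.Geometry.Lorentzian.SpacetimeConstSmul
import Literature.Geometry.Lorentzian.KerrConvergence
import Literature.Geometry.Lorentzian.ChartSecondFundamentalForm
import HarnessLib

/-!
# Late-time charts precomposed with a dilation of the reference domain

Bookkeeping for the dilation covariance of the consequence-form convergence notions of
`KerrConvergence.lean`. Let `𝓢 = (M, g, τ)` be a spacetime, `c > 0`, and `𝓢.constSmul (c²)` the
rescaled spacetime `(M, c² g, τ)` (`SpacetimeConstSmul.lean`). Let `B`, `B'` be two reference
backgrounds related by the dilation `y ↦ c y` of `ℝ⁴` — `y ∈ U' ↔ c y ∈ U`, `g₀'(y) = g₀(c y)`,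
`t(c y) = c t'(y)`, `r(c y) = c r'(y)` (as for the boosted Kerr–Schild family,
`BoostedKerrDilation.lean`, and for Minkowski space) — and `δ : U' → U` the dilation. For a chart
`Ψ : U → M` we compare `Ψ` measured against `(c² g, B)` with `Ψ ∘ δ` measured against `(g, B')`:

* `deviation_comp_dilate`: `((Ψ ∘ δ)^* g − g₀')(y) = (Ψ^*(c² g) − g₀)(c y)` as bilinear forms on
  `ℝ⁴` (chain rule, `d δ = c • id`), hence `deviationExtend_comp_dilate` (the junk-extended
  deviations agree up to the dilation) and, by the chain rule for iterated derivatives under a linear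
  change of variables (`norm_iteratedFDeriv_comp_smul_le`: `‖Dᵐ(F ∘ c•)(y)‖ ≤ |c|ᵐ ‖DᵐF(cy)‖`),
  `deviationCk_comp_dilate_le` / `truncDeviationCk_comp_dilate_le`: the `Cᵏ` deviations of `Ψ ∘ δ`
  on the slabs `{t' = τ}` (truncated at `r' ≤ R`) are at most `max(1, cᵏ)` times those of `Ψ` on
  `{t = c τ}` (truncated at `r ≤ c R`), so decay transfers (`tendsto_deviationCk_comp_dilate`,
  `tendsto_truncDeviationCk_comp_dilate`);
* `isLateChart_comp_dilate`: `Ψ ∘ δ` is a late-time chart after `c⁻¹ τ₀` if `Ψ` is one after `τ₀`;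
* `image_comp_dilate`, with the membership lemmas `dilate_mem_lateRegion_iff`, `…timeSlab…`,
  `…truncTimeSlab…`, `…truncLateRegion…`: the images of the (truncated) late regions and slabs
  correspond (`τ ↦ c τ`, `R ↦ c R`).

Everything is elementary calculus; no definitions, no named facts (DHRT arXiv:2104.08222, §1, and
Klainerman–Szeftel 2023, Thm. 1.1, are the sources of the notions being transported).

## References

* M. Dafermos, G. Holzegel, I. Rodnianski, M. Taylor, arXiv:2104.08222, §1. [arXiv210408222]
* R. P. Kerr, A. Schild (1965), §2 (scale covariance of the Kerr–Schild family). [KerrSchild1965]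
-/

noncomputable section

open Manifold Bundle TopologicalSpace Set Filter Topology
open scoped ContDiff ENNReal

universe u

namespace Literature.Geometry.Lorentzian

/-! ### Iterated derivatives and `Cᵏ` sup norms under `y ↦ c y` -/

section SupNorm

variable {F V : Type*} [NormedAddCommGroup F] [NormedSpace ℝ F] [NormedAddCommGroup V]
  [NormedSpace ℝ V]

/-- **Iterated derivatives of a dilated function**: `‖Dᵐ(y ↦ F(c y))(x)‖ ≤ |c|ᵐ ‖DᵐF(c x)‖` for
`c ≠ 0` (composition with the linear equivalence `c • id` on the right; no differentiability
needed). [folklore] -/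
theorem norm_iteratedFDeriv_comp_smul_le (f : F → V) {c : ℝ} (hc : c ≠ 0) (m : ℕ) (x : F) :
    ‖iteratedFDeriv ℝ m (fun y ↦ f (c • y)) x‖ ≤ |c| ^ m * ‖iteratedFDeriv ℝ m f (c • x)‖ := by
  obtain ⟨L, hL⟩ : ∃ L : F ≃L[ℝ] F, ∀ y, L y = c • y :=
    ⟨ContinuousLinearEquiv.equivOfInverse (c • ContinuousLinearMap.id ℝ F)
      (c⁻¹ • ContinuousLinearMap.id ℝ F)
      (fun y ↦ by simp [smul_smul, mul_inv_cancel₀ hc]) (fun y ↦ by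
        simp [smul_smul, inv_mul_cancel₀ hc]), fun y ↦ rfl⟩
  have hfun : (fun y ↦ f (c • y)) = f ∘ L := funext fun y ↦ by rw [Function.comp_apply, hL]
  have hcomp := L.iteratedFDerivWithin_comp_right f uniqueDiffOn_univ (x := x) (Set.mem_univ _) m
  rw [Set.preimage_univ, iteratedFDerivWithin_univ, iteratedFDerivWithin_univ] at hcomp
  rw [hfun, hcomp, hL]
  refine (ContinuousMultilinearMap.norm_compContinuousLinearMap_le _ _).trans ?_
  rw [Finset.prod_const, Finset.card_univ, Fintype.card_fin, mul_comm]
  have hLn : ‖(L : F →L[ℝ] F)‖ ≤ |c| := by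
    refine ContinuousLinearMap.opNorm_le_bound _ (abs_nonneg c) fun y ↦ ?_
    rw [ContinuousLinearEquiv.coe_coe, hL, norm_smul, Real.norm_eq_abs]
  exact mul_le_mul_of_nonneg_right (pow_le_pow_left₀ (norm_nonneg _) hLn m) (norm_nonneg _)

/-- `|c|ᵐ ≤ max(1, |c|ᵏ)` for `m ≤ k`: the uniform constant in `supCkENorm_comp_smul_le`. [folklore] -/
theorem abs_pow_le_max_one_abs_pow {c : ℝ} {m k : ℕ} (hm : m ≤ k) : |c| ^ m ≤ max 1 (|c| ^ k) := by
  rcases le_or_gt 1 |c| with h | h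
  · exact (pow_le_pow_right₀ h hm).trans (le_max_right _ _)
  · exact (pow_le_one₀ (abs_nonneg c) h.le).trans (le_max_left _ _)

/-- **`Cᵏ` sup norms of a dilated function**:
`supCkENorm S k (y ↦ F(c y)) ≤ max(1, |c|ᵏ) · supCkENorm (c • S) k F` (`c ≠ 0`). [folklore] -/
theorem supCkENorm_comp_smul_le (S : Set F) (k : ℕ) (f : F → V) {c : ℝ} (hc : c ≠ 0) :
    supCkENorm S k (fun y ↦ f (c • y)) ≤
      ENNReal.ofReal (max 1 (|c| ^ k)) * supCkENorm ((fun y ↦ c • y) '' S) k f := by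
  refine iSup₂_le fun m hm ↦ iSup₂_le fun x hx ↦ ?_
  have hC : 0 ≤ max 1 (|c| ^ k) := zero_le_one.trans (le_max_left _ _)
  have h1 := (norm_iteratedFDeriv_comp_smul_le f hc m x).trans
    (mul_le_mul_of_nonneg_right (abs_pow_le_max_one_abs_pow hm) (norm_nonneg _))
  calc ‖iteratedFDeriv ℝ m (fun y ↦ f (c • y)) x‖ₑ
      = ENNReal.ofReal ‖iteratedFDeriv ℝ m (fun y ↦ f (c • y)) x‖ := (ofReal_norm _).symm
    _ ≤ ENNReal.ofReal (max 1 (|c| ^ k) * ‖iteratedFDeriv ℝ m f (c • x)‖) :=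
        ENNReal.ofReal_le_ofReal h1
    _ = ENNReal.ofReal (max 1 (|c| ^ k)) * ‖iteratedFDeriv ℝ m f (c • x)‖ₑ := by
        rw [ENNReal.ofReal_mul hC, ofReal_norm]
    _ ≤ _ := mul_le_mul_right
        (enorm_iteratedFDeriv_le_supCkENorm hm (Set.mem_image_of_mem _ hx) f) _

end SupNorm

/-! ### The dilation between reference domains -/

section Dilate

variable {c : ℝ} {B B' : ModelBackground} {δ : B'.domain → B.domain}

/-- A map `δ : U' → U` between open subsets of `ℝ⁴` which is the dilation `y ↦ c y` in coordinates
is smooth. [folklore] -/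
theorem contMDiff_dilate (hδ : ∀ x, (δ x : E4) = c • (x : E4)) :
    ContMDiff 𝓘(ℝ, E4) 𝓘(ℝ, E4) ∞ δ := by
  refine (ContMDiff.subtypeVal_comp_iff _ _).1 ?_
  have h : Subtype.val ∘ δ = fun x : B'.domain ↦ c • (x : E4) := funext hδ
  rw [h]
  exact (c • ContinuousLinearMap.id ℝ E4).contDiff.contMDiff.comp contMDiff_subtype_val

/-- The dilation `δ` is continuous. [folklore] -/
theorem continuous_dilate (hδ : ∀ x, (δ x : E4) = c • (x : E4)) : Continuous δ :=
  (contMDiff_dilate hδ).continuous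

/-- The differential of the dilation is `v ↦ c v`. [folklore] -/
theorem mfderiv_dilate_apply (hδ : ∀ x, (δ x : E4) = c • (x : E4)) (x : B'.domain)
    (v : TangentSpace 𝓘(ℝ, E4) x) : mfderiv 𝓘(ℝ, E4) 𝓘(ℝ, E4) δ x v = c • v := by
  rw [OpensChart.mfderiv_apply_of_repr (f := δ) (Φ := fun y : E4 ↦ c • y) hδ
    ((c • ContinuousLinearMap.id ℝ E4).differentiableAt)]
  exact congrFun (congrArg DFunLike.coe ((c • ContinuousLinearMap.id ℝ E4).fderiv)) v

/-- The dilation is surjective as soon as the domains correspond (`y ∈ U' ↔ c y ∈ U`, `c ≠ 0`). [folklore] -/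
theorem surjective_dilate (hc : c ≠ 0) (hδ : ∀ x, (δ x : E4) = c • (x : E4))
    (hdom : ∀ y : E4, y ∈ B'.domain ↔ c • y ∈ B.domain) : Function.Surjective δ := fun y ↦
  ⟨⟨c⁻¹ • (y : E4), (hdom _).2 (by rw [smul_inv_smul₀ hc]; exact y.2)⟩,
    Subtype.ext (by rw [hδ]; exact smul_inv_smul₀ hc _)⟩

/-- Images correspond under a surjective dilation: if `δ x ∈ S ↔ x ∈ S'` then
`(Ψ ∘ δ)(S') = Ψ(S)`. [folklore] -/
theorem image_comp_dilate {Y : Type*} (Ψ : B.domain → Y) (hsurj : Function.Surjective δ)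
    {S' : Set B'.domain} {S : Set B.domain} (hS : ∀ x, δ x ∈ S ↔ x ∈ S') :
    (Ψ ∘ δ) '' S' = Ψ '' S := by
  rw [Set.image_comp]
  congr 1
  ext y
  refine ⟨?_, fun hy ↦ ?_⟩
  · rintro ⟨x, hx, rfl⟩
    exact (hS x).2 hx
  · obtain ⟨x, rfl⟩ := hsurj y
    exact ⟨x, (hS x).1 hy, rfl⟩

variable (hc : 0 < c) (hδ : ∀ x, (δ x : E4) = c • (x : E4))
  (htime : ∀ y : E4, B.time (c • y) = c * B'.time y)
  (hrad : ∀ y : E4, B.radius (c • y) = c * B'.radius y)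
include hδ htime

/-- Time functions correspond: `t(δ x) = c t'(x)`. [folklore] -/
theorem time_dilate (x : B'.domain) : B.time (δ x) = c * B'.time x := by rw [hδ, htime]

include hc

/-- Late regions correspond: `δ x ∈ {t > c τ} ↔ x ∈ {t' > τ}`. [folklore] -/
theorem dilate_mem_lateRegion_iff (τ : ℝ) (x : B'.domain) :
    δ x ∈ B.lateRegion (c * τ) ↔ x ∈ B'.lateRegion τ := by
  rw [ModelBackground.mem_lateRegion, ModelBackground.mem_lateRegion, time_dilate hδ htime,
    mul_lt_mul_iff_right₀ hc]

/-- Time slabs correspond: `δ x ∈ {t = c τ} ↔ x ∈ {t' = τ}`. [folklore] -/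
theorem dilate_mem_timeSlab_iff (τ : ℝ) (x : B'.domain) :
    δ x ∈ B.timeSlab (c * τ) ↔ x ∈ B'.timeSlab τ := by
  rw [ModelBackground.mem_timeSlab, ModelBackground.mem_timeSlab, time_dilate hδ htime]
  exact (mul_right_injective₀ hc.ne').eq_iff

include hrad

omit hc htime in
/-- Radius functions correspond: `r(δ x) = c r'(x)`. [folklore] -/
theorem radius_dilate (x : B'.domain) : B.radius (δ x) = c * B'.radius x := by rw [hδ, hrad]

/-- Truncated slabs correspond: `δ x ∈ {t = cτ, r ≤ cR} ↔ x ∈ {t' = τ, r' ≤ R}`. [folklore] -/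
theorem dilate_mem_truncTimeSlab_iff (R τ : ℝ) (x : B'.domain) :
    δ x ∈ B.truncTimeSlab (c * R) (c * τ) ↔ x ∈ B'.truncTimeSlab R τ := by
  rw [ModelBackground.mem_truncTimeSlab, ModelBackground.mem_truncTimeSlab, time_dilate hδ htime,
    radius_dilate hδ hrad, mul_le_mul_iff_right₀ hc]
  exact and_congr (mul_right_injective₀ hc.ne').eq_iff Iff.rfl

/-- Truncated late regions correspond: `δ x ∈ {t > cτ₁, r ≤ cR} ↔ x ∈ {t' > τ₁, r' ≤ R}`. [folklore] -/
theorem dilate_mem_truncLateRegion_iff (τ₁ R : ℝ) (x : B'.domain) :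
    δ x ∈ B.truncLateRegion (c * τ₁) (c * R) ↔ x ∈ B'.truncLateRegion τ₁ R := by
  rw [ModelBackground.mem_truncLateRegion, ModelBackground.mem_truncLateRegion,
    time_dilate hδ htime, radius_dilate hδ hrad, mul_lt_mul_iff_right₀ hc,
    mul_le_mul_iff_right₀ hc]

end Dilate

/-! ### Deviations of `Ψ ∘ δ` against `(g, B')` versus `Ψ` against `(c² g, B)` -/

namespace Spacetime

variable (𝓢 : Spacetime.{u} 4) {c : ℝ} (hc : 0 < c) {B B' : ModelBackground}
  {δ : B'.domain → B.domain} (hδ : ∀ x, (δ x : E4) = c • (x : E4))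
  (hdom : ∀ y : E4, y ∈ B'.domain ↔ c • y ∈ B.domain)
  (hbil : ∀ y : E4, B'.bilin y = B.bilin (c • y))
  (htime : ∀ y : E4, B.time (c • y) = c * B'.time y)
  (hrad : ∀ y : E4, B.radius (c • y) = c * B'.radius y)

include hδ hbil in
/-- **The deviation of `Ψ ∘ δ` from `B'` in `(M, g)` is the deviation of `Ψ` from `B` in
`(M, c² g)`, at the dilated point**: `((Ψ∘δ)^* g − g₀')(x) = (Ψ^*(c² g) − g₀)(δ x)` (both are
`c² g(dΨ ·, dΨ ·) − g₀(c x)`, by the chain rule with `dδ = c • id`). DHRT arXiv:2104.08222, §1 (the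
notion); scale covariance of the reference family. [cite: arXiv210408222, §1] -/
theorem deviation_comp_dilate {Ψ : B.domain → 𝓢.carrier} (hΨ : ContMDiff 𝓘(ℝ, E4) (𝓡 4) ∞ Ψ)
    (x : B'.domain) :
    𝓢.deviation B' (Ψ ∘ δ) x = (𝓢.constSmul (c ^ 2) (pow_pos hc 2)).deviation B Ψ (δ x) := by
  have hδd : MDifferentiableAt 𝓘(ℝ, E4) 𝓘(ℝ, E4) δ x :=
    (contMDiff_dilate hδ).mdifferentiableAt (by simp)
  have hΨd : MDifferentiableAt 𝓘(ℝ, E4) (𝓡 4) Ψ (δ x) := hΨ.mdifferentiableAt (by simp)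
  -- chain rule, with all vectors based at `δ x`
  have hcomp : ∀ v : TangentSpace 𝓘(ℝ, E4) (δ x), mfderiv 𝓘(ℝ, E4) (𝓡 4) (Ψ ∘ δ) x v =
      c • mfderiv 𝓘(ℝ, E4) (𝓡 4) Ψ (δ x) v := fun v ↦ by
    rw [mfderiv_comp x hΨd hδd]
    show mfderiv 𝓘(ℝ, E4) (𝓡 4) Ψ (δ x) (mfderiv 𝓘(ℝ, E4) 𝓘(ℝ, E4) δ x v) = _
    rw [show mfderiv 𝓘(ℝ, E4) 𝓘(ℝ, E4) δ x v = c • v from mfderiv_dilate_apply hδ x v, map_smul]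
  ext v w
  change 𝓢.metric.val (Ψ (δ x)) (mfderiv 𝓘(ℝ, E4) (𝓡 4) (Ψ ∘ δ) x v)
      (mfderiv 𝓘(ℝ, E4) (𝓡 4) (Ψ ∘ δ) x w) - B'.bilin x v w =
    c ^ 2 * 𝓢.metric.val (Ψ (δ x)) (mfderiv 𝓘(ℝ, E4) (𝓡 4) Ψ (δ x) v)
      (mfderiv 𝓘(ℝ, E4) (𝓡 4) Ψ (δ x) w) - B.bilin (δ x) v w
  rw [hcomp v, hcomp w, hbil, ← hδ]
  simp only [map_smul, FunLike.coe_smul, Pi.smul_apply, smul_eq_mul]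
  ring

include hδ hbil hdom in
/-- The junk-extended deviations agree up to the dilation of `ℝ⁴`:
`deviationExtend (g, B') (Ψ ∘ δ) = deviationExtend (c² g, B) Ψ ∘ (c •)` (on `U'` by
`deviation_comp_dilate`, off `U'` both vanish since `y ∈ U' ↔ c y ∈ U`). [cite: arXiv210408222, §1] -/
theorem deviationExtend_comp_dilate {Ψ : B.domain → 𝓢.carrier}
    (hΨ : ContMDiff 𝓘(ℝ, E4) (𝓡 4) ∞ Ψ) :
    𝓢.deviationExtend B' (Ψ ∘ δ) =
      fun y ↦ (𝓢.constSmul (c ^ 2) (pow_pos hc 2)).deviationExtend B Ψ (c • y) := by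
  funext y
  by_cases hy : y ∈ B'.domain
  · obtain ⟨x, rfl⟩ : ∃ x : B'.domain, (x : E4) = y := ⟨⟨y, hy⟩, rfl⟩
    rw [deviationExtend_coe, ← hδ, deviationExtend_coe, 𝓢.deviation_comp_dilate hc hδ hbil hΨ]
  · rw [𝓢.deviationExtend_of_not_mem B' _ hy,
      (𝓢.constSmul (c ^ 2) (pow_pos hc 2)).deviationExtend_of_not_mem B _ (mt (hdom y).2 hy)]

include hδ hbil hdom htime in
/-- **`Cᵏ` deviations on slabs transfer under the dilation**:
`deviationCk (g, B') (Ψ∘δ) k τ ≤ max(1, cᵏ) · deviationCk (c² g, B) Ψ k (c τ)` (the dilation maps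
the slab `{t' = τ}` into `{t = c τ}`; `supCkENorm_comp_smul_le`). [cite: arXiv210408222, §1] -/
theorem deviationCk_comp_dilate_le {Ψ : B.domain → 𝓢.carrier} (hΨ : ContMDiff 𝓘(ℝ, E4) (𝓡 4) ∞ Ψ)
    (k : ℕ) (τ : ℝ) :
    𝓢.deviationCk B' (Ψ ∘ δ) k τ ≤ ENNReal.ofReal (max 1 (|c| ^ k)) *
      (𝓢.constSmul (c ^ 2) (pow_pos hc 2)).deviationCk B Ψ k (c * τ) := by
  unfold deviationCk
  rw [𝓢.deviationExtend_comp_dilate hc hδ hdom hbil hΨ]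
  refine (supCkENorm_comp_smul_le _ k _ hc.ne').trans (mul_le_mul_right (supCkENorm_mono ?_ _ _) _)
  rintro _ ⟨_, ⟨x, hx, rfl⟩, rfl⟩
  refine ⟨⟨c • (x : E4), (hdom _).1 x.2⟩, ?_, rfl⟩
  rw [ModelBackground.mem_timeSlab] at hx ⊢
  change B.time (c • (x : E4)) = c * τ
  rw [htime, hx]

include hδ hbil hdom htime hrad in
/-- **Truncated `Cᵏ` deviations transfer under the dilation**:
`truncDeviationCk (g, B') (Ψ∘δ) k R τ ≤ max(1, cᵏ) · truncDeviationCk (c² g, B) Ψ k (cR) (cτ)`.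
[cite: arXiv210408222, §1] -/
theorem truncDeviationCk_comp_dilate_le {Ψ : B.domain → 𝓢.carrier}
    (hΨ : ContMDiff 𝓘(ℝ, E4) (𝓡 4) ∞ Ψ) (k : ℕ) (R τ : ℝ) :
    𝓢.truncDeviationCk B' (Ψ ∘ δ) k R τ ≤ ENNReal.ofReal (max 1 (|c| ^ k)) *
      (𝓢.constSmul (c ^ 2) (pow_pos hc 2)).truncDeviationCk B Ψ k (c * R) (c * τ) := by
  unfold truncDeviationCk
  rw [𝓢.deviationExtend_comp_dilate hc hδ hdom hbil hΨ]
  refine (supCkENorm_comp_smul_le _ k _ hc.ne').trans (mul_le_mul_right (supCkENorm_mono ?_ _ _) _)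
  rintro _ ⟨_, ⟨x, hx, rfl⟩, rfl⟩
  refine ⟨⟨c • (x : E4), (hdom _).1 x.2⟩, ?_, rfl⟩
  rw [ModelBackground.mem_truncTimeSlab] at hx ⊢
  change B.time (c • (x : E4)) = c * τ ∧ B.radius (c • (x : E4)) ≤ c * R
  rw [htime, hrad, hx.1]
  exact ⟨rfl, mul_le_mul_of_nonneg_left hx.2 hc.le⟩

include hδ hbil hdom htime in
/-- **Decay of the slab deviations transfers under the dilation** (`deviationCk_comp_dilate_le`
and `τ ↦ c τ → ∞`). [cite: arXiv210408222, §1] -/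
theorem tendsto_deviationCk_comp_dilate {Ψ : B.domain → 𝓢.carrier}
    (hΨ : ContMDiff 𝓘(ℝ, E4) (𝓡 4) ∞ Ψ) {k : ℕ}
    (h : Tendsto (fun τ ↦ (𝓢.constSmul (c ^ 2) (pow_pos hc 2)).deviationCk B Ψ k τ) atTop (𝓝 0)) :
    Tendsto (fun τ ↦ 𝓢.deviationCk B' (Ψ ∘ δ) k τ) atTop (𝓝 0) := by
  have h1 : Tendsto (fun τ ↦ ENNReal.ofReal (max 1 (|c| ^ k)) *
      (𝓢.constSmul (c ^ 2) (pow_pos hc 2)).deviationCk B Ψ k (c * τ)) atTop (𝓝 0) := by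
    have h2 := ENNReal.Tendsto.const_mul (a := ENNReal.ofReal (max 1 (|c| ^ k)))
      (h.comp (tendsto_id.const_mul_atTop hc)) (Or.inr ENNReal.ofReal_ne_top)
    rw [mul_zero] at h2
    exact h2
  exact tendsto_of_tendsto_of_tendsto_of_le_of_le tendsto_const_nhds h1 (fun _ ↦ zero_le)
    fun τ ↦ 𝓢.deviationCk_comp_dilate_le hc hδ hdom hbil htime hΨ k τ

include hδ hbil hdom htime hrad in
/-- **Decay of truncated deviations with (possibly growing) radii transfers under the dilation**:
if `truncDeviationCk (c² g, B) Ψ k (R τ) τ → 0` then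
`truncDeviationCk (g, B') (Ψ ∘ δ) k (c⁻¹ R(c τ)) τ → 0`. [cite: arXiv210408222, §1] -/
theorem tendsto_truncDeviationCk_comp_dilate {Ψ : B.domain → 𝓢.carrier}
    (hΨ : ContMDiff 𝓘(ℝ, E4) (𝓡 4) ∞ Ψ) {k : ℕ} {R : ℝ → ℝ}
    (h : Tendsto (fun τ ↦ (𝓢.constSmul (c ^ 2) (pow_pos hc 2)).truncDeviationCk B Ψ k (R τ) τ)
      atTop (𝓝 0)) :
    Tendsto (fun τ ↦ 𝓢.truncDeviationCk B' (Ψ ∘ δ) k (c⁻¹ * R (c * τ)) τ) atTop (𝓝 0) := by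
  have h1 : Tendsto (fun τ ↦ ENNReal.ofReal (max 1 (|c| ^ k)) *
      (𝓢.constSmul (c ^ 2) (pow_pos hc 2)).truncDeviationCk B Ψ k (R (c * τ)) (c * τ))
      atTop (𝓝 0) := by
    have h2 := ENNReal.Tendsto.const_mul (a := ENNReal.ofReal (max 1 (|c| ^ k)))
      (h.comp (tendsto_id.const_mul_atTop hc)) (Or.inr ENNReal.ofReal_ne_top)
    rw [mul_zero] at h2
    exact h2
  refine tendsto_of_tendsto_of_tendsto_of_le_of_le tendsto_const_nhds h1 (fun _ ↦ zero_le)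
    fun τ ↦ ?_
  have h2 := 𝓢.truncDeviationCk_comp_dilate_le hc hδ hdom hbil htime hrad hΨ k (c⁻¹ * R (c * τ)) τ
  rwa [mul_inv_cancel_left₀ hc.ne'] at h2

/-! ### Late-time charts -/

include hδ hdom htime in
/-- **A late-time chart precomposed with the dilation is a late-time chart**: if `Ψ : U → M` is a
late-time chart of `(M, c² g)` into `O` after `τ₀` (modelled on `B`), then `Ψ ∘ δ : U' → M` is a
late-time chart of `(M, g)` into `O` after `c⁻¹ τ₀` (modelled on `B'`): `δ` is smooth, restricts to a
homeomorphism `{t' > c⁻¹τ₀} ≃ {t > τ₀}`, and the images of the late regions coincide.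
DHRT arXiv:2104.08222, §1 (the notion). [cite: arXiv210408222, §1] -/
theorem isLateChart_comp_dilate {O : Set 𝓢.carrier} {τ₀ : ℝ} {Ψ : B.domain → 𝓢.carrier}
    (hΨ : (𝓢.constSmul (c ^ 2) (pow_pos hc 2)).IsLateChart B O τ₀ Ψ) :
    𝓢.IsLateChart B' O (c⁻¹ * τ₀) (Ψ ∘ δ) := by
  have hc0 : c ≠ 0 := hc.ne'
  have hcont : Continuous δ := continuous_dilate hδ
  -- the inverse dilation on the late regions
  have hmem : ∀ w : B.lateRegion τ₀, c⁻¹ • ((w : B.domain) : E4) ∈ B'.domain := fun w ↦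
    (hdom _).2 (by rw [smul_inv_smul₀ hc0]; exact w.1.2)
  have hlate : ∀ w : B.lateRegion τ₀,
      (⟨c⁻¹ • ((w : B.domain) : E4), hmem w⟩ : B'.domain) ∈ B'.lateRegion (c⁻¹ * τ₀) := fun w ↦ by
    have hw : τ₀ < B.time ((w : B.domain) : E4) := w.2
    rw [ModelBackground.mem_lateRegion]
    have ht := htime (c⁻¹ • ((w : B.domain) : E4))
    rw [smul_inv_smul₀ hc0] at ht
    change c⁻¹ * τ₀ < B'.time (c⁻¹ • ((w : B.domain) : E4))
    have ht' : B'.time (c⁻¹ • ((w : B.domain) : E4)) = c⁻¹ * B.time ((w : B.domain) : E4) := by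
      rw [ht, inv_mul_cancel_left₀ hc0]
    rw [ht']
    exact mul_lt_mul_of_pos_left hw (inv_pos.2 hc)
  have hlate' : ∀ z : B'.lateRegion (c⁻¹ * τ₀), δ z.1 ∈ B.lateRegion τ₀ := fun z ↦ by
    have h := (dilate_mem_lateRegion_iff hc hδ htime (c⁻¹ * τ₀) z.1).2 z.2
    rwa [mul_inv_cancel_left₀ hc0] at h
  let e : B'.lateRegion (c⁻¹ * τ₀) ≃ₜ B.lateRegion τ₀ :=
    { toFun := fun z ↦ ⟨δ z.1, hlate' z⟩
      invFun := fun w ↦ ⟨⟨c⁻¹ • ((w : B.domain) : E4), hmem w⟩, hlate w⟩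
      left_inv := fun z ↦ Subtype.ext (Subtype.ext (by
        change c⁻¹ • ((δ z.1 : B.domain) : E4) = _
        rw [hδ, inv_smul_smul₀ hc0]))
      right_inv := fun w ↦ Subtype.ext (Subtype.ext (by
        change ((δ _ : B.domain) : E4) = _
        rw [hδ]
        exact smul_inv_smul₀ hc0 _))
      continuous_toFun := (hcont.comp continuous_subtype_val).subtype_mk _
      continuous_invFun := (((continuous_const_smul c⁻¹).comp
        (continuous_subtype_val.comp continuous_subtype_val)).subtype_mk _).subtype_mk _ }
  refine ⟨hΨ.contMDiff.comp (contMDiff_dilate hδ), ?_, ?_⟩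
  · have hfac : (B'.lateRegion (c⁻¹ * τ₀)).restrict (Ψ ∘ δ) = (B.lateRegion τ₀).restrict Ψ ∘ e := rfl
    rw [hfac]
    exact hΨ.isOpenEmbedding.comp e.isOpenEmbedding
  · rintro _ ⟨x, hx, rfl⟩
    exact hΨ.image_subset ⟨δ x, hlate' ⟨x, hx⟩, rfl⟩

end Spacetime

end Literature.Geometry.Lorentzian

end
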